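import Summits.Ventures.YMGap.RobustBall.MassGapOnBallS
import HarnessLib

/-!
# Venture YMGap, track ROBUST-BALL (tier 2) — geometry of axial plaquette pairs on `ℤ^d`

HONEST FRAMING. WHAT THIS IS: a venture file (cell `pub-ymgap`, track Y2 ROBUST-BALL, seat rb-p1), the
lattice COMBINATORICS behind the infinite-range member `AxialPairWitness.lean` of the tier-2 ball. An
AXIAL PLAQUETTE PAIR is indexed by `i = (p, a, n)`: the plaquette `p`, a lattice direction `a` and a gap
`n : ℕ`; its partner is the parallel translate `partner i = p + (n + 1) e_a` and its carrier the link set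
`axialCode i = edges p ∪ edges (partner i)` (every unordered pair of distinct parallel plaquettes on a
common lattice axis arises exactly once). We prove: (1) links of `p` and of `partner i` have base points
at `ℓ^∞`-distance `≤ n + 2`, and the first links of `p` and `partner i` are at distance `≥ n + 1`;
(2) the fibres `{i : axialCode i = X}` are finite, with an explicit `Finset` enumeration `axialFib X`;
(3) THE INDEX-SUM BOUND: for a nonnegative summable gap profile `w`, every finite partial sum of
`(𝟙[e ∈ edges p] + 𝟙[e ∈ edges (partner i)]) · w n` over indices is `≤ 4 d (d - 1) ∑_n w n` (at most
`2(d - 1)` plaquettes through a link, `d` directions, and translation is injective). WHAT IT IS NOT: no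
measure, no estimate, no number about a Gibbs state; nothing about the continuum limit or the Clay problem.

References: folklore lattice geometry; the counting `|{p ∋ e}| ≤ 2(d - 1)` is the tree's
`card_plaquettesTouching_singleton_le` (Shen–Zhu–Zhu, CMP 400 (2023), §2).
-/

noncomputable section

open Filter Function Topology Real Finset
open Literature.Probability.LatticeModels
open Literature.MathematicalPhysics.QuantumLattice
open Literature.MathematicalPhysics.QuantumFieldTheory hiding ZdEdge

namespace Summit.Ventures.YMGap.RobustBall

variable {d : ℕ}

/-! ### Axial shifts, partners and carriers -/

/-- The axial shift vector `(n + 1) e_a ∈ ℤ^d`. -/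
def axialShift (a : Fin d) (n : ℕ) : Site d := Pi.single a ((n : ℤ) + 1)

/-- The `a`-coordinate of the shift is `n + 1`. -/
@[simp] theorem axialShift_apply_self (a : Fin d) (n : ℕ) : axialShift a n a = (n : ℤ) + 1 := by
  simp [axialShift]

/-- The other coordinates of the shift vanish. -/
theorem axialShift_apply_of_ne {a b : Fin d} (h : b ≠ a) (n : ℕ) : axialShift a n b = 0 := by
  simp [axialShift, Pi.single_eq_of_ne h]

/-- Every coordinate of the shift has absolute value `≤ n + 1`. -/
theorem abs_axialShift_apply_le (a b : Fin d) (n : ℕ) : |((axialShift a n b : ℤ) : ℝ)| ≤ (n : ℝ) + 1 := by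
  by_cases h : b = a
  · subst h; rw [axialShift_apply_self]; push_cast; rw [abs_of_nonneg (by positivity)]
  · rw [axialShift_apply_of_ne h]; push_cast; rw [abs_zero]; positivity

variable (d) in
/-- The index set of axial plaquette pairs: (plaquette, direction, gap). -/
abbrev AxialIdx : Type := ZdPlaquette d × Fin d × ℕ

/-- The partner plaquette `p + (n + 1) e_a` (same orientation). -/
def partner (i : AxialIdx d) : ZdPlaquette d := (i.1.1 + axialShift i.2.1 i.2.2, i.1.2)

/-- The carrier of an axial pair: the links of the two plaquettes. -/
def axialCode (i : AxialIdx d) : Finset (ZdEdge d) := plaquetteEdges i.1 ∪ plaquetteEdges (partner i)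

/-- The first link of a plaquette lies on it. -/
theorem fst_mem_plaquetteEdges (p : ZdPlaquette d) : (p.1, p.2.1.1) ∈ plaquetteEdges p := by
  simp [plaquetteEdges]

/-- The first link of `p` lies on the carrier. -/
theorem fst_mem_axialCode (i : AxialIdx d) : (i.1.1, i.1.2.1.1) ∈ axialCode i :=
  mem_union_left _ (fst_mem_plaquetteEdges i.1)

/-- The first link of the partner lies on the carrier. -/
theorem partner_fst_mem_axialCode (i : AxialIdx d) :
    (i.1.1 + axialShift i.2.1 i.2.2, i.1.2.1.1) ∈ axialCode i :=
  mem_union_right _ (fst_mem_plaquetteEdges (partner i))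

/-- Translation of plaquettes is injective: the re-basing map `i ↦ (partner i, a, n)` is injective. -/
theorem rebase_injective : Injective fun i : AxialIdx d => ((partner i, i.2.1, i.2.2) : AxialIdx d) := by
  rintro ⟨⟨x, o⟩, a, n⟩ ⟨⟨x', o'⟩, a', n'⟩ h
  simp only [partner, Prod.mk.injEq] at h
  obtain ⟨⟨hx, ho⟩, ha, hn⟩ := h
  subst ha hn ho
  have hx' : x = x' := add_right_cancel hx
  subst hx'
  rfl

/-! ### Distances -/

/-- Links of a plaquette and of its axial partner at gap `n` have base points at `ℓ^∞`-distance
`≤ n + 2` (offsets inside a plaquette are `0` or `1` per coordinate, the shift is `n + 1` in one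
coordinate). -/
theorem norm_sub_le_of_mem_of_mem_partner {i : AxialIdx d} {e y : ZdEdge d} (he : e ∈ plaquetteEdges i.1)
    (hy : y ∈ plaquetteEdges (partner i)) : ‖e.1 - y.1‖ ≤ (i.2.2 : ℝ) + 2 := by
  refine (pi_norm_le_iff_of_nonneg (by positivity)).2 fun k => ?_
  rw [Pi.sub_apply, Int.norm_eq_abs, Int.cast_sub]
  have h1 := apply_sub_eq_zero_or_one_of_mem_plaquetteEdges he k
  have h2 := apply_sub_eq_zero_or_one_of_mem_plaquetteEdges hy k
  have hs := abs_axialShift_apply_le i.2.1 k i.2.2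
  simp only [partner, Pi.add_apply] at h2
  have : ((e.1 k : ℤ) : ℝ) - (y.1 k : ℝ) =
      ((e.1 k - i.1.1 k : ℤ) : ℝ) - ((y.1 k - (i.1.1 k + axialShift i.2.1 i.2.2 k) : ℤ) : ℝ) -
        ((axialShift i.2.1 i.2.2 k : ℤ) : ℝ) := by
    push_cast; ring
  rw [this]
  rcases h1 with h1 | h1 <;> rcases h2 with h2 | h2 <;> rw [h1, h2] <;>
    · have := abs_le.1 hs
      rw [abs_le]; constructor <;> push_cast <;> linarith [this.1, this.2]

/-- The same bound with the roles exchanged. -/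
theorem norm_sub_le_of_mem_partner_of_mem {i : AxialIdx d} {e y : ZdEdge d}
    (he : e ∈ plaquetteEdges (partner i)) (hy : y ∈ plaquetteEdges i.1) : ‖e.1 - y.1‖ ≤ (i.2.2 : ℝ) + 2 := by
  rw [← norm_neg, neg_sub]; exact norm_sub_le_of_mem_of_mem_partner hy he

/-- The first links of a plaquette and of its partner at gap `n` are at distance `≥ n + 1`: the carrier
has arbitrarily large diameter (INFINITE RANGE of the axial-pair family). -/
theorem le_norm_fst_sub_partner_fst (i : AxialIdx d) :
    (i.2.2 : ℝ) + 1 ≤ ‖(i.1.1 : Site d) - (i.1.1 + axialShift i.2.1 i.2.2)‖ := by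
  have h := norm_le_pi_norm ((i.1.1 : Site d) - (i.1.1 + axialShift i.2.1 i.2.2)) i.2.1
  refine le_trans (le_of_eq ?_) h
  rw [Pi.sub_apply, Pi.add_apply, axialShift_apply_self, Int.norm_eq_abs]
  push_cast
  rw [show ((i.1.1 i.2.1 : ℤ) : ℝ) - ((i.1.1 i.2.1 : ℤ) + ((i.2.2 : ℝ) + 1)) = -((i.2.2 : ℝ) + 1) by ring,
    abs_neg, abs_of_nonneg (by positivity)]

/-! ### Finite fibres of the carrier map -/

/-- The finitely many candidate gaps of a link set: `((e'.1 a - e.1 a) - 1).toNat` over `e, e' ∈ X`, `a`. -/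
def axialGaps (X : Finset (ZdEdge d)) : Finset ℕ :=
  ((X ×ˢ X) ×ˢ (univ : Finset (Fin d))).image fun t => (t.1.2.1 t.2 - t.1.1.1 t.2 - 1).toNat

/-- On the fibre of `X` the gap is a candidate gap of `X` (read off the first links of the two plaquettes). -/
theorem gap_mem_axialGaps {i : AxialIdx d} {X : Finset (ZdEdge d)} (h : axialCode i = X) :
    i.2.2 ∈ axialGaps X := by
  have h1 : (i.1.1, i.1.2.1.1) ∈ X := h ▸ fst_mem_axialCode i
  have h2 : (i.1.1 + axialShift i.2.1 i.2.2, i.1.2.1.1) ∈ X := h ▸ partner_fst_mem_axialCode i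
  refine mem_image.2 ⟨(((i.1.1, i.1.2.1.1), (i.1.1 + axialShift i.2.1 i.2.2, i.1.2.1.1)), i.2.1),
    mem_product.2 ⟨mem_product.2 ⟨h1, h2⟩, mem_univ _⟩, ?_⟩
  simp only [Pi.add_apply, axialShift_apply_self]
  rw [show i.1.1 i.2.1 + ((i.2.2 : ℤ) + 1) - i.1.1 i.2.1 - 1 = ((i.2.2 : ℕ) : ℤ) by ring]
  exact Int.toNat_natCast i.2.2

/-- On the fibre of `X` the plaquette touches `X`. -/
theorem fst_mem_plaquettesTouching {i : AxialIdx d} {X : Finset (ZdEdge d)} (h : axialCode i = X) :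
    i.1 ∈ plaquettesTouching X :=
  mem_plaquettesTouching_iff.2 ⟨(i.1.1, i.1.2.1.1), mem_inter.2 ⟨fst_mem_plaquetteEdges i.1, h ▸ fst_mem_axialCode i⟩⟩

/-- **The fibre enumeration**: the finitely many axial pairs carried by the link set `X`. -/
def axialFib (X : Finset (ZdEdge d)) : Finset (AxialIdx d) :=
  ((plaquettesTouching X) ×ˢ ((univ : Finset (Fin d)) ×ˢ axialGaps X)).filter fun i => axialCode i = X

/-- Membership in the fibre enumeration is exactly `axialCode i = X`. -/
theorem mem_axialFib (X : Finset (ZdEdge d)) (i : AxialIdx d) : i ∈ axialFib X ↔ axialCode i = X := by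
  unfold axialFib
  rw [mem_filter, mem_product, mem_product]
  constructor
  · exact fun h => h.2
  · intro h
    exact ⟨⟨fst_mem_plaquettesTouching h, mem_univ _, gap_mem_axialGaps h⟩, h⟩

/-! ### The index-sum bound through a link -/

section Sums

variable {w : ℕ → ℝ}

/-- **Partial sums over pairs whose FIRST plaquette contains `e`**:
`∑_{i ∈ S} 𝟙[e ∈ edges p_i] w(n_i) ≤ 2(d - 1) · d · ∑_n w n`. -/
theorem sum_ite_fst_le (hd : 1 ≤ d) (hw0 : ∀ n, 0 ≤ w n) (hw : Summable w) (e : ZdEdge d)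
    (S : Finset (AxialIdx d)) :
    ∑ i ∈ S, (if e ∈ plaquetteEdges i.1 then w i.2.2 else 0) ≤ 2 * ((d : ℝ) - 1) * d * ∑' n, w n := by
  classical
  set T : Finset (AxialIdx d) := (plaquettesTouching {e}) ×ˢ ((univ : Finset (Fin d)) ×ˢ S.image fun i => i.2.2)
    with hT
  have hstep1 : ∑ i ∈ S, (if e ∈ plaquetteEdges i.1 then w i.2.2 else 0) =
      ∑ i ∈ S.filter (fun i => e ∈ plaquetteEdges i.1), w i.2.2 := by
    rw [sum_filter]
  have hsub : S.filter (fun i => e ∈ plaquetteEdges i.1) ⊆ T := by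
    intro i hi
    obtain ⟨hiS, hie⟩ := mem_filter.1 hi
    exact mem_product.2 ⟨mem_plaquettesTouching_singleton.2 hie,
      mem_product.2 ⟨mem_univ _, mem_image.2 ⟨i, hiS, rfl⟩⟩⟩
  have hstep2 : ∑ i ∈ S.filter (fun i => e ∈ plaquetteEdges i.1), w i.2.2 ≤ ∑ i ∈ T, w i.2.2 :=
    sum_le_sum_of_subset_of_nonneg hsub fun i _ _ => hw0 _
  have hstep3 : ∑ i ∈ T, w i.2.2 =
      ((plaquettesTouching {e}).card : ℝ) * (d * ∑ n ∈ S.image (fun i => i.2.2), w n) := by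
    have hinner : ∀ x : ZdPlaquette d,
        ∑ y ∈ (univ : Finset (Fin d)) ×ˢ S.image (fun i => i.2.2), w ((x, y) : AxialIdx d).2.2 =
          d * ∑ n ∈ S.image (fun i => i.2.2), w n := by
      intro x
      rw [sum_product]
      change ∑ a ∈ (univ : Finset (Fin d)), ∑ n ∈ S.image (fun i => i.2.2), w n = _
      rw [sum_const, nsmul_eq_mul, card_univ, Fintype.card_fin]
    rw [hT, sum_product]
    change ∑ x ∈ plaquettesTouching {e}, ∑ y ∈ (univ : Finset (Fin d)) ×ˢ S.image (fun i => i.2.2),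
      w ((x, y) : AxialIdx d).2.2 = _
    rw [sum_congr rfl fun x _ => hinner x, sum_const, nsmul_eq_mul]
  have hgeo : ∑ n ∈ S.image (fun i => i.2.2), w n ≤ ∑' n, w n := hw.sum_le_tsum _ (fun n _ => hw0 n)
  have hcard : ((plaquettesTouching {e}).card : ℝ) ≤ 2 * ((d : ℝ) - 1) := by
    calc ((plaquettesTouching {e}).card : ℝ) ≤ ((2 * (d - 1) : ℕ) : ℝ) := by
          exact_mod_cast card_plaquettesTouching_singleton_le e
      _ = 2 * ((d : ℝ) - 1) := by push_cast [Nat.cast_sub hd]; ring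
  have htsum0 : 0 ≤ ∑' n, w n := tsum_nonneg hw0
  have hd0 : (0 : ℝ) ≤ d := Nat.cast_nonneg d
  rw [hstep1]
  refine hstep2.trans ?_
  rw [hstep3]
  calc ((plaquettesTouching {e}).card : ℝ) * (d * ∑ n ∈ S.image (fun i => i.2.2), w n)
      ≤ (2 * ((d : ℝ) - 1)) * (d * ∑' n, w n) :=
        mul_le_mul hcard (mul_le_mul_of_nonneg_left hgeo hd0) (mul_nonneg hd0 (sum_nonneg fun n _ => hw0 n))
          (by linarith [hcard, (Nat.cast_nonneg _ : (0 : ℝ) ≤ (plaquettesTouching {e}).card)])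
    _ = 2 * ((d : ℝ) - 1) * d * ∑' n, w n := by ring

/-- **Partial sums over pairs whose PARTNER contains `e`**: re-basing at the partner is injective, so the
same bound holds: `∑_{i ∈ S} 𝟙[e ∈ edges (partner i)] w(n_i) ≤ 2(d - 1) · d · ∑_n w n`. -/
theorem sum_ite_partner_le (hd : 1 ≤ d) (hw0 : ∀ n, 0 ≤ w n) (hw : Summable w) (e : ZdEdge d)
    (S : Finset (AxialIdx d)) :
    ∑ i ∈ S, (if e ∈ plaquetteEdges (partner i) then w i.2.2 else 0) ≤ 2 * ((d : ℝ) - 1) * d * ∑' n, w n := by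
  classical
  have h := sum_ite_fst_le hd hw0 hw e (S.image fun i : AxialIdx d => ((partner i, i.2.1, i.2.2) : AxialIdx d))
  rw [sum_image (fun i _ j _ hij => rebase_injective hij)] at h
  exact h

/-- **THE INDEX-SUM BOUND through a link**: for a nonnegative summable gap profile `w`,
`∑_{i ∈ S} (𝟙[e ∈ edges p_i] + 𝟙[e ∈ edges (partner i)]) w(n_i) ≤ 4 d (d - 1) ∑_n w n`
for every finite set `S` of axial pairs. -/
theorem sum_incidence_mul_le (hd : 1 ≤ d) (hw0 : ∀ n, 0 ≤ w n) (hw : Summable w) (e : ZdEdge d)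
    (S : Finset (AxialIdx d)) :
    ∑ i ∈ S, ((if e ∈ plaquetteEdges i.1 then (1 : ℝ) else 0) +
        (if e ∈ plaquetteEdges (partner i) then (1 : ℝ) else 0)) * w i.2.2 ≤
      4 * d * ((d : ℝ) - 1) * ∑' n, w n := by
  have h1 := sum_ite_fst_le hd hw0 hw e S
  have h2 := sum_ite_partner_le hd hw0 hw e S
  have heq : ∑ i ∈ S, ((if e ∈ plaquetteEdges i.1 then (1 : ℝ) else 0) +
      (if e ∈ plaquetteEdges (partner i) then (1 : ℝ) else 0)) * w i.2.2 =
      ∑ i ∈ S, (if e ∈ plaquetteEdges i.1 then w i.2.2 else 0) +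
        ∑ i ∈ S, (if e ∈ plaquetteEdges (partner i) then w i.2.2 else 0) := by
    rw [← sum_add_distrib]
    refine sum_congr rfl fun i _ => ?_
    split_ifs <;> ring
  rw [heq]
  calc _ ≤ 2 * ((d : ℝ) - 1) * d * ∑' n, w n + 2 * ((d : ℝ) - 1) * d * ∑' n, w n := add_le_add h1 h2
    _ = 4 * d * ((d : ℝ) - 1) * ∑' n, w n := by ring

/-- Summability form of the index-sum bound: a nonnegative index family dominated by
`(𝟙[e ∈ edges p] + 𝟙[e ∈ edges (partner i)]) w(n)` is summable with sum `≤ 4 d (d - 1) ∑_n w n`. -/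
theorem summable_and_tsum_le_of_le_incidence (hd : 1 ≤ d) (hw0 : ∀ n, 0 ≤ w n) (hw : Summable w)
    (e : ZdEdge d) {g : AxialIdx d → ℝ} (hg0 : ∀ i, 0 ≤ g i)
    (hg : ∀ i, g i ≤ ((if e ∈ plaquetteEdges i.1 then (1 : ℝ) else 0) +
        (if e ∈ plaquetteEdges (partner i) then (1 : ℝ) else 0)) * w i.2.2) :
    Summable g ∧ ∑' i, g i ≤ 4 * d * ((d : ℝ) - 1) * ∑' n, w n := by
  have hS : ∀ S : Finset (AxialIdx d), ∑ i ∈ S, g i ≤ 4 * d * ((d : ℝ) - 1) * ∑' n, w n := fun S =>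
    (sum_le_sum fun i _ => hg i).trans (sum_incidence_mul_le hd hw0 hw e S)
  exact ⟨summable_of_sum_le hg0 hS, Real.tsum_le_of_sum_le hg0 hS⟩

/-- The geometric gap profile: `∑_n r^{n+1} = r / (1 - r)` for `0 ≤ r < 1`. -/
theorem tsum_pow_succ_eq {r : ℝ} (h0 : 0 ≤ r) (h1 : r < 1) : ∑' n : ℕ, r ^ (n + 1) = r / (1 - r) := by
  simp_rw [pow_succ]
  rw [tsum_mul_right, tsum_geometric_of_lt_one h0 h1, div_eq_inv_mul]

/-- Summability of the geometric gap profile. -/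
theorem summable_pow_succ {r : ℝ} (h0 : 0 ≤ r) (h1 : r < 1) : Summable fun n : ℕ => r ^ (n + 1) := by
  simp_rw [pow_succ]
  exact (summable_geometric_of_lt_one h0 h1).mul_right r

end Sums

end Summit.Ventures.YMGap.RobustBall
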